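import Summits.BirchSwinnertonDyer.Rank1Residual.Additive.InvariantClassCountAssembly
import Summits.BirchSwinnertonDyer.Rank1Residual.Additive.StrictSignedSelmerInftyLocal
import Summits.BirchSwinnertonDyer.Rank1Residual.Additive.CyclotomicTowerSignedLocalIndex
import HarnessLib

/-!
# Invariant classes modulo `p^m` in Kobayashi's zero-clause minus group up the `κ`-tower — the
# elementary corank bound of brick B3 (cell `b2b-bsdres`, CLASS-CLOSURE lane, class O10 — x1b GEN 39,
# class lead; file 81 of the series)

HONEST FRAMING (cell `b2b-bsdres`, run/shared/lean/b2b/bsd-rank1-residual/, verbatim in every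
file): the goal of the cell is to DELETE the COMBINATION-SHAPED residual classes of the
Birch–Swinnerton-Dyer formula for ALL analytic-rank `≤ 1` elliptic curves over `ℚ` — "full BSD
formula for every rank `≤ 1` curve in class `C`" assembled STRICTLY from published theorems — so
that the rank-`≤ 1` remainder becomes exactly the CONSTRUCTION-SHAPED classes, which are TYPED
(missing-input `Prop`s), NOT attempted. This is not "finishing BSD". CLASS-CLOSURE lane: prove
what is provable now; shrink each hard class to its core with data; no claim beyond stated classes;
research routes on CONSTRUCTION-SHAPED X12 / O10; census / instrument output = EVIDENCE / conjecture
items, NEVER a Literature fact; `RESIDUAL-MAP.md` marks change only by signed lines. THIS FILE: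
TOOL THEOREMS ONLY — no definition, no named Literature fact, no `sorry`, axioms standard; nothing
is booked; no label / mark / count / sub-cell moves; (C1_η), (C2_η-GZ), (C3_η) stay typed as filed
(cc-typer-6's pen); nothing about `BSD(W, p)` of any pair is claimed.

## What

Brick B3 of the count (C) (files 60–78: `#(A₀⧸S₀) = p^ν · Tam(W)^{(p)}` for the `p*`-twist `W`)
wants the level-`m` minus line at `p` — `C_m` cyclic of order `p^m`, transverse to the Kummer group
`𝓚_p` — i.e. the corank-ONE half of [Kobayashi2003] Thm. 6.2 on the `η`-component, filed by GEN 37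
as FACT-level. Transversality (`C⁻ ∩ 𝓚 = 0`, "`u(p) = 0`") is kernel since GEN 31/32 and bounds
`#C_m ≤ p^m`. This file is the POINT-LEVEL engine of the bound `#C_m ≥ p^m` WITHOUT Coleman maps
(files 79/80 `InvariantClassCountAlgebra/Assembly` supply the algebra), for ANY field `K`,
`ℤ_p`-extension `κ`, `K`-field `E`, embedding `ι`, curve `W`, and the tree's zero-clause minus
group `N = E⁻(K_n·E) ⊓ ker Tr_{n/0}` (`signedLocalPointsOfEmb κ ι W (-1) n ⊓ (localTraceOfEmb κ ι W
0 n).ker`, whose Kummer condition IS p17's strict one: `SignedTwist.localKummerOverOfEmb_strictSigned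
_eq_zeroClause`):

* §1 `pow_prime_pow_mem_localLayerSubgroupOfEmb` (`g^{p^k} ∈ Gal(K̄_E/K_k·E)` for EVERY `g ∈ Γ_E`),
  `index_local_layer_zero_dvd` (`[K_n·E : K_0·E] ∣ p^n`), `mem_zero_of_smul_eq`,
  **`eq_zero_of_smul_eq_of_mem_zeroClause`** (`N^g = 0` when `g` generates the layer quotients and
  `E(K_n·E)` has no `p`-torsion: a `g`-fixed zero-clause point is a bottom point killed by
  `Tr_{n/0} = [K_n·E : E]`, a `p`-power);
* §2 `smul_mem_zeroClause` (`N` is `Γ_E`-stable), `zeroClause_mono` (and `N ≤ E^{−,str}`: the tree's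
  `SignedTwist.signed_inf_ker_le_strictSigned`);
* §3 **`exists_finset_zeroClause_invariant_mod_pow`**: if `g ∈ Γ_E` generates every layer quotient
  below `n` (`hgen`), `E(K_n·E)` has no `p`-torsion (`htors`, Prop. 8.7 — kernel for the curves of
  the lane), and `S` is a set of layers `1 ≤ k ≤ n` each carrying a WITNESS `w ∈ E⁻(K_k·E) ∩ ker
  Tr_{k/0}` not of the form `p·a + b` (`a ∈ E(K_k·E)`, `b ∈ E(K_{k−1}·E)`), then for every `m`
  there are `p^{min(m,#S)}` points `x ∈ N` with `g•x − x ∈ p^m N`, pairwise incongruent modulo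
  `p^m N`.

HOW IT CLOSES B3 (the remaining steps, for the next files; nothing of this is claimed here):
(i) WITNESSES at every odd `k` (Kobayashi's `c_k`, Prop. 8.12: `E⁺(K_k) ≤ E(K_{k−1})` for odd `k`,
so `E(K_k)^{odd} = E(K_{k−1}) + E⁻(K_k)^{odd}` and a NEW odd point modulo `p` exists by the formal
logarithm; transported to `W` by the SignedTwist dictionary); (ii) DESCENT: the Kummer classes of the
`x` modulo `p^m` are `#S ≥ m ⟹ p^m` DISTINCT `Gal(K_n·E/E)`-invariant classes of `H¹(K_n·E, W[p^m])`
inside the minus condition (`N` is `p`-saturated, Lemma 8.17 — kernel), and `H¹(E, W[p^m]) ≅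
H¹(K_n·E, W[p^m])^{Gal}` (no `p`-torsion); (iii) with transversality and `#H¹(E, W[p])/𝓚 = p` the
level-`m` minus condition `Σ_m` is cyclic of order exactly `p^m` and `Σ_m ⊕ 𝓚_p = H¹(E, W[p^m])`.

References: [Kobayashi2003] S. Kobayashi, Invent. Math. 152 (2003), §2 p. 4, Def. 1.1 / 2.1,
Thm. 6.2 (p. 11), Prop. 8.7 (p. 16), Prop. 8.12 (p. 17), Lemma 8.17 (p. 19); [GreenbergLNM1716]
R. Greenberg, LNM 1716, §3.
-/

noncomputable section

open scoped Classical

universe u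

namespace Summit.BirchSwinnertonDyer.Rank1Residual.Additive.StrictSignedCount

open Literature.NumberTheory.EllipticCurves Literature.NumberTheory.GaloisRepresentations
  Literature.NumberTheory.EllipticCurves.Kobayashi2003 ZpExtension
  Summit.BirchSwinnertonDyer.Rank1Residual.Additive
  Summit.BirchSwinnertonDyer.Rank1Residual.Additive.InvariantCount

variable {K : Type u} [Field K] {p : ℕ} [hp : Fact p.Prime] (κ : ZpExtension K p)
  {E : Type u} [Field E] [Algebra K E] (ι : AlgebraicClosure K →ₐ[K] AlgebraicClosure E)
  (W : WeierstrassCurve K)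

/-! ### §1 Tower bookkeeping for one element `g ∈ Γ_E` -/

/-- `g^{p^k} ∈ Gal(K̄_E/K_k·E)` for EVERY `g ∈ Γ_E` (`κ(g^{p^k}) = p^k·κ(g)`). [folklore] -/
theorem pow_prime_pow_mem_localLayerSubgroupOfEmb (g : Field.absoluteGaloisGroup E) (k : ℕ) :
    g ^ p ^ k ∈ localLayerSubgroupOfEmb κ ι k := by
  rw [mem_localLayerSubgroupOfEmb_iff, map_pow, map_pow, toAdd_pow, nsmul_eq_mul, Nat.cast_pow]
  exact Dvd.intro _ rfl

/-- `g^{p^k}` fixes `E(K_k·E)` pointwise. [folklore] -/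
theorem pow_prime_pow_smul_of_mem (g : Field.absoluteGaloisGroup E) (k : ℕ)
    {P : localPoints W E} (hP : P ∈ localLayerPointsOfEmb κ ι W k) : (g ^ p ^ k) • P = P :=
  (mem_localLayerPointsOfEmb_iff κ ι W k P).mp hP _ (pow_prime_pow_mem_localLayerSubgroupOfEmb κ ι g k)

/-- The local layer index `[K_n·E : K_0·E]` divides `p^n`. [folklore] -/
theorem index_local_layer_zero_dvd (n : ℕ) :
    ((localSubgroupOfEmb (κ.layerSubgroup n) ι).subgroupOf
        (localSubgroupOfEmb (κ.layerSubgroup 0) ι)).index ∣ p ^ n :=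
  index_localSubgroupOfEmb_subgroupOf_dvd ι _ _
    (by rw [relIndex_layerSubgroup_eq_pow κ (Nat.zero_le n), Nat.sub_zero])

/-- A point fixed by `g` descends to the bottom layer when `g` generates every layer quotient below
`n`. [folklore] -/
theorem mem_zero_of_smul_eq (g : Field.absoluteGaloisGroup E) (n : ℕ)
    (hgen : ∀ k < n, ∀ P ∈ localLayerPointsOfEmb κ ι W (k + 1), (g ^ p ^ k) • P = P →
      P ∈ localLayerPointsOfEmb κ ι W k)
    {z : localPoints W E} (hzn : z ∈ localLayerPointsOfEmb κ ι W n) (hgz : g • z = z) :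
    z ∈ localLayerPointsOfEmb κ ι W 0 := by
  have hpow : ∀ j : ℕ, (g ^ j) • z = z := fun j => by
    induction j with
    | zero => rw [pow_zero, one_smul]
    | succ j ih => rw [pow_succ, mul_smul, hgz, ih]
  have hdesc : ∀ j ≤ n, z ∈ localLayerPointsOfEmb κ ι W (n - j) := by
    intro j
    induction j with
    | zero => exact fun _ => by simpa using hzn
    | succ j ih =>
      intro hj
      have hk : n - (j + 1) < n := by omega
      have hz' : z ∈ localLayerPointsOfEmb κ ι W (n - (j + 1) + 1) := by
        rw [show n - (j + 1) + 1 = n - j by omega]; exact ih (by omega)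
      exact hgen (n - (j + 1)) hk z hz' (hpow _)
  simpa using hdesc n le_rfl

/-- **Zero-clause minus points fixed by `g` vanish** (`g` generating the layer quotients below `n`,
no `p`-torsion in `E(K_n·E)`): such a point lies in `E(K_0·E)`, where `Tr_{n/0}` is multiplication
by the local index `[K_n·E : K_0·E] ∣ p^n`. [cite: Kobayashi2003, §2 p. 4, Prop. 8.7 (p. 16)] -/
theorem eq_zero_of_smul_eq_of_mem_zeroClause (g : Field.absoluteGaloisGroup E) (n : ℕ)
    (hgen : ∀ k < n, ∀ P ∈ localLayerPointsOfEmb κ ι W (k + 1), (g ^ p ^ k) • P = P →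
      P ∈ localLayerPointsOfEmb κ ι W k)
    (htors : ∀ P ∈ localLayerPointsOfEmb κ ι W n, p • P = 0 → P = 0)
    {z : localPoints W E}
    (hz : z ∈ signedLocalPointsOfEmb κ ι W (-1) n ⊓ (localTraceOfEmb κ ι W 0 n).ker)
    (hgz : g • z = z) : z = 0 := by
  have hzn : z ∈ localLayerPointsOfEmb κ ι W n := (signedLocalPointsOfEmb_le κ ι W (-1) n) hz.1
  have hz0 : z ∈ localLayerPointsOfEmb κ ι W 0 := mem_zero_of_smul_eq κ ι W g n hgen hzn hgz
  have htr : localTraceOfEmb κ ι W 0 n z = 0 := (AddMonoidHom.mem_ker).mp hz.2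
  rw [localTraceOfEmb_apply_of_mem_lower κ ι W 0 n hz0] at htr
  exact noTorsion_of_dvd_pow (localLayerPointsOfEmb κ ι W n) htors (index_local_layer_zero_dvd κ ι n)
    z hzn htr

/-! ### §2 The zero-clause minus group and its layer filtration -/

/-- `E⁻(K_n·E) ∩ ker Tr_{n/0}` is `Γ_E`-stable. [cite: Kobayashi2003, §2 p. 4] -/
theorem smul_mem_zeroClause (g : Field.absoluteGaloisGroup E) (n : ℕ) {P : localPoints W E}
    (hP : P ∈ signedLocalPointsOfEmb κ ι W (-1) n ⊓ (localTraceOfEmb κ ι W 0 n).ker) :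
    g • P ∈ signedLocalPointsOfEmb κ ι W (-1) n ⊓ (localTraceOfEmb κ ι W 0 n).ker := by
  obtain ⟨hPs, hPk⟩ := AddSubgroup.mem_inf.mp hP
  have hPn : P ∈ localLayerPointsOfEmb κ ι W n := signedLocalPointsOfEmb_le κ ι W (-1) n hPs
  refine AddSubgroup.mem_inf.mpr ⟨?_, ?_⟩
  · rw [signedLocalPointsOfEmb_eq_towerSigned] at hPs ⊢
    exact smul_mem_towerSignedLocalPointsOfEmb κ.layerSubgroup ι W (-1) n g hPs
  · rw [AddMonoidHom.mem_ker] at hPk ⊢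
    rw [localTraceOfEmb_eq_localPairTraceOfEmb,
      ← smul_localPairTraceOfEmb_of_normal ι W (κ.layerSubgroup 0) (κ.layerSubgroup n) g hPn,
      ← localTraceOfEmb_eq_localPairTraceOfEmb, hPk, smul_zero]

/-- A zero-clause minus point of layer `k ≤ n` is one of layer `n`. [cite: Kobayashi2003, §2 p. 4] -/
theorem zeroClause_mono {k n : ℕ} (hkn : k ≤ n) {w : localPoints W E}
    (hw : w ∈ signedLocalPointsOfEmb κ ι W (-1) k ⊓ (localTraceOfEmb κ ι W 0 k).ker) :
    w ∈ signedLocalPointsOfEmb κ ι W (-1) n ⊓ (localTraceOfEmb κ ι W 0 n).ker := by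
  obtain ⟨hws, hwk⟩ := AddSubgroup.mem_inf.mp hw
  have hwk' : w ∈ localLayerPointsOfEmb κ ι W k := signedLocalPointsOfEmb_le κ ι W (-1) k hws
  refine AddSubgroup.mem_inf.mpr ⟨signedLocalPointsOfEmb_mono κ ι W (-1) hkn hws, ?_⟩
  rw [AddMonoidHom.mem_ker] at hwk ⊢
  rw [localTraceOfEmb_eq_localPairTraceOfEmb,
    localPairTraceOfEmb_of_mem_mid κ.layerSubgroup ι W κ.layerSubgroup_antitone (Nat.zero_le k) hkn hwk',
    ← localTraceOfEmb_eq_localPairTraceOfEmb, hwk, smul_zero]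

/-! ### §3 The count -/

/-- **`p^{min(m,#S)}` zero-clause minus points at layer `n`, `g`-invariant and pairwise incongruent
modulo `p^m`.** Let `g ∈ Γ_E` generate every layer quotient `Gal(K_{k+1}·E / K_k·E)`, `k < n`
(`hgen`: a point of `E(K_{k+1}·E)` fixed by `g^{p^k}` lies in `E(K_k·E)`), let `E(K_n·E)` have no
`p`-torsion (Prop. 8.7), and let `S` be a set of layers `1 ≤ k ≤ n` each carrying a WITNESS: a point
`w ∈ E⁻(K_k·E)` with `Tr_{k/0} w = 0` which is not of the form `p·a + b`, `a ∈ E(K_k·E)`,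
`b ∈ E(K_{k−1}·E)` (for Kobayashi's tower: every odd `k`, by Prop. 8.12 and the points `c_k` —
supplied by the caller). Then for every `m` there are `p^{min(m,#S)}` points `x` of the zero-clause
minus group `N = E⁻(K_n·E) ∩ ker Tr_{n/0}` with `g•x − x ∈ p^m N`, pairwise incongruent modulo
`p^m N`. Their Kummer classes modulo `p^m` are that many DISTINCT `Gal(K_n·E/E)`-invariant classes in
the minus condition (Lemma 8.17: `N` is `p`-saturated), which descend to `H¹(E, E[p^m])`: the
elementary replacement of the corank-one half of [K] Thm. 6.2 in brick B3 of the count (C).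
[cite: Kobayashi2003, §2 p. 4, Def. 1.1, Thm. 6.2 (p. 11), Prop. 8.7 (p. 16), Prop. 8.12 (p. 17)] -/
theorem exists_finset_zeroClause_invariant_mod_pow (g : Field.absoluteGaloisGroup E) (n : ℕ)
    (hgen : ∀ k < n, ∀ P ∈ localLayerPointsOfEmb κ ι W (k + 1), (g ^ p ^ k) • P = P →
      P ∈ localLayerPointsOfEmb κ ι W k)
    (htors : ∀ P ∈ localLayerPointsOfEmb κ ι W n, p • P = 0 → P = 0)
    (S : Finset ℕ) (hS0 : 0 ∉ S) (hSn : ∀ k ∈ S, k ≤ n)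
    (hwit : ∀ k ∈ S, ∃ w ∈ signedLocalPointsOfEmb κ ι W (-1) k ⊓ (localTraceOfEmb κ ι W 0 k).ker,
      ¬ ∃ a ∈ localLayerPointsOfEmb κ ι W k, ∃ b ∈ localLayerPointsOfEmb κ ι W (k - 1),
        w = p • a + b)
    (m : ℕ) :
    ∃ X : Finset (localPoints W E), X.card = p ^ min m S.card ∧
      (∀ x ∈ X, x ∈ signedLocalPointsOfEmb κ ι W (-1) n ⊓ (localTraceOfEmb κ ι W 0 n).ker ∧
        ∃ y ∈ signedLocalPointsOfEmb κ ι W (-1) n ⊓ (localTraceOfEmb κ ι W 0 n).ker,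
          g • x - x = p ^ m • y) ∧
      (∀ x ∈ X, ∀ x' ∈ X,
        (∃ w ∈ signedLocalPointsOfEmb κ ι W (-1) n ⊓ (localTraceOfEmb κ ι W 0 n).ker,
          x - x' = p ^ m • w) → x = x') := by
  set γ : Module.End ℤ (localPoints W E) := DistribMulAction.toModuleEnd ℤ (localPoints W E) g
    with hγdef
  have hγ : ∀ x, γ x = g • x := fun x => rfl
  have hγpow : ∀ (j : ℕ) (x : localPoints W E), (γ ^ j) x = (g ^ j) • x := fun j x => by
    rw [hγdef, ← map_pow]; rfl
  set N := signedLocalPointsOfEmb κ ι W (-1) n ⊓ (localTraceOfEmb κ ι W 0 n).ker with hNdef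
  have hNW : N ≤ localLayerPointsOfEmb κ ι W n := fun x hx => signedLocalPointsOfEmb_le κ ι W (-1) n hx.1
  obtain ⟨X, hXcard, hXN, hXdist⟩ := exists_finset_invariant_mod_pow γ hp.out
    (localLayerPointsOfEmb κ ι W) N n hNW
    (fun k x hx => (hγ x) ▸ smul_mem_localFixedPointsOfEmb ι W (κ.layerSubgroup k) g hx)
    (fun x hx => (hγ x) ▸ smul_mem_zeroClause κ ι W g n hx)
    (fun k => localLayerPointsOfEmb_mono κ ι W (Nat.le_succ k))
    (fun k x hx => by rw [hγpow]; exact pow_prime_pow_smul_of_mem κ ι W g k hx)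
    (fun k hk x hx hfix => hgen k hk x hx (by rw [← hγpow]; exact hfix))
    htors
    (fun z hz hgz => eq_zero_of_smul_eq_of_mem_zeroClause κ ι W g n hgen htors hz ((hγ z) ▸ hgz))
    S hS0 hSn
    (fun k hk => by
      obtain ⟨w, hw, hwnot⟩ := hwit k hk
      refine ⟨w, ⟨zeroClause_mono κ ι W (hSn k hk) hw, signedLocalPointsOfEmb_le κ ι W (-1) k hw.1⟩,
        fun ⟨a, ha, b, hb, hab⟩ => hwnot ⟨a, ha.2, b, hb.2, hab⟩⟩)
    m
  refine ⟨X, hXcard, fun x hx => ?_, hXdist⟩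
  obtain ⟨hxN, y, hy, hxy⟩ := hXN x hx
  exact ⟨hxN, y, hy, (hγ x) ▸ hxy⟩

/-- **The zero-clause group is `p^j`-saturated in `E(K_n·E)`** (Lemma 8.17 for the signed part —
the tree's `towerSignedLocalPointsOfEmb_saturated` — and `Tr_{n/0}(p^j w) = p^j Tr_{n/0} w` for the
clause; no `p`-torsion in `E(K_n·E)`). [cite: Kobayashi2003, Lemma 8.17 (p. 19), Prop. 8.7 (p. 16)] -/
theorem mem_zeroClause_of_pow_smul_mem (n j : ℕ)
    (htors : ∀ P ∈ localLayerPointsOfEmb κ ι W n, p • P = 0 → P = 0)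
    {w : localPoints W E} (hw : w ∈ localLayerPointsOfEmb κ ι W n)
    (hpw : p ^ j • w ∈ signedLocalPointsOfEmb κ ι W (-1) n ⊓ (localTraceOfEmb κ ι W 0 n).ker) :
    w ∈ signedLocalPointsOfEmb κ ι W (-1) n ⊓ (localTraceOfEmb κ ι W 0 n).ker := by
  obtain ⟨hs, hk⟩ := AddSubgroup.mem_inf.mp hpw
  have htors' : ∀ P ∈ localLayerPointsOfEmb κ ι W n, p ^ j • P = 0 → P = 0 :=
    noTorsion_pow (localLayerPointsOfEmb κ ι W n) htors j
  refine AddSubgroup.mem_inf.mpr ⟨?_, ?_⟩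
  · rw [signedLocalPointsOfEmb_eq_towerSigned] at hs ⊢
    exact towerSignedLocalPointsOfEmb_saturated ι W κ.layerSubgroup κ.layerSubgroup_antitone (-1) n
      htors' hw hs
  · rw [AddMonoidHom.mem_ker] at hk ⊢
    rw [map_nsmul] at hk
    exact htors' _ (localLayerPointsOfEmb_mono κ ι W (Nat.zero_le n)
      (localTraceOfEmb_mem_of_mem κ ι W 0 n hw)) hk

/-- **Corollary: pairwise incongruent modulo `p^m·E(K_n·E)`** (the congruence the Kummer map at layer
`n` sees): same hypotheses, same count, by the `p^m`-saturation of the zero-clause group.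
[cite: Kobayashi2003, Thm. 6.2 (p. 11), Prop. 8.7 (p. 16), Lemma 8.17 (p. 19)] -/
theorem exists_finset_zeroClause_invariant_mod_pow_layer (g : Field.absoluteGaloisGroup E) (n : ℕ)
    (hgen : ∀ k < n, ∀ P ∈ localLayerPointsOfEmb κ ι W (k + 1), (g ^ p ^ k) • P = P →
      P ∈ localLayerPointsOfEmb κ ι W k)
    (htors : ∀ P ∈ localLayerPointsOfEmb κ ι W n, p • P = 0 → P = 0)
    (S : Finset ℕ) (hS0 : 0 ∉ S) (hSn : ∀ k ∈ S, k ≤ n)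
    (hwit : ∀ k ∈ S, ∃ w ∈ signedLocalPointsOfEmb κ ι W (-1) k ⊓ (localTraceOfEmb κ ι W 0 k).ker,
      ¬ ∃ a ∈ localLayerPointsOfEmb κ ι W k, ∃ b ∈ localLayerPointsOfEmb κ ι W (k - 1),
        w = p • a + b)
    (m : ℕ) :
    ∃ X : Finset (localPoints W E), X.card = p ^ min m S.card ∧
      (∀ x ∈ X, x ∈ signedLocalPointsOfEmb κ ι W (-1) n ⊓ (localTraceOfEmb κ ι W 0 n).ker ∧
        ∃ y ∈ signedLocalPointsOfEmb κ ι W (-1) n ⊓ (localTraceOfEmb κ ι W 0 n).ker,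
          g • x - x = p ^ m • y) ∧
      (∀ x ∈ X, ∀ x' ∈ X,
        (∃ w ∈ localLayerPointsOfEmb κ ι W n, x - x' = p ^ m • w) → x = x') := by
  obtain ⟨X, hXcard, hXN, hXdist⟩ :=
    exists_finset_zeroClause_invariant_mod_pow κ ι W g n hgen htors S hS0 hSn hwit m
  refine ⟨X, hXcard, hXN, fun x hx x' hx' ⟨w, hw, hxx⟩ => hXdist x hx x' hx' ⟨w, ?_, hxx⟩⟩
  refine mem_zeroClause_of_pow_smul_mem κ ι W n m htors hw ?_
  rw [← hxx]
  exact AddSubgroup.sub_mem _ (hXN x hx).1 (hXN x' hx').1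

/-! ### §4 Discharging `hgen`: an element of unit `κ`-value generates every layer quotient -/

/-- **Coset decomposition from ONE element with `κ(g|_{K̄}) ∈ ℤ_pˣ`**: every
`τ ∈ Gal(K̄_E/K_k·E)` is `(g^{p^k})^i · u` with `u ∈ Gal(K̄_E/K_{k+1}·E)` (`i ≡ κ(τ)p^{−k}·κ(g)⁻¹
mod p`). [folklore] -/
theorem exists_eq_pow_mul_of_isUnit (g : Field.absoluteGaloisGroup E)
    (hg : IsUnit (κ (resGalOfEmb ι g)).toAdd) (k : ℕ) {τ : Field.absoluteGaloisGroup E}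
    (hτ : τ ∈ localLayerSubgroupOfEmb κ ι k) :
    ∃ i : ℕ, ∃ u ∈ localLayerSubgroupOfEmb κ ι (k + 1), τ = (g ^ p ^ k) ^ i * u := by
  rw [mem_localLayerSubgroupOfEmb_iff] at hτ
  obtain ⟨a, ha⟩ := hτ
  obtain ⟨c, hc⟩ := hg
  set i : ℕ := (PadicInt.toZMod (a * ((c⁻¹ : ℤ_[p]ˣ) : ℤ_[p]))).val with hi
  set u : Field.absoluteGaloisGroup E := ((g ^ p ^ k) ^ i)⁻¹ * τ with hu
  have hdiv : (p : ℤ_[p]) ∣ a - (i : ℤ_[p]) * (c : ℤ_[p]) := by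
    have hker : PadicInt.toZMod (a - (i : ℤ_[p]) * (c : ℤ_[p])) = 0 := by
      rw [map_sub, map_mul, map_natCast, hi, ZMod.natCast_zmod_val, map_mul, mul_assoc, ← map_mul,
        Units.inv_mul, map_one, mul_one, sub_self]
    have hmem : a - (i : ℤ_[p]) * (c : ℤ_[p]) ∈ RingHom.ker (PadicInt.toZMod (p := p)) := hker
    rwa [PadicInt.ker_toZMod, PadicInt.maximalIdeal_eq_span_p, Ideal.mem_span_singleton] at hmem
  have humem : u ∈ localLayerSubgroupOfEmb κ ι (k + 1) := by
    rw [mem_localLayerSubgroupOfEmb_iff, hu, map_mul, map_inv, map_mul, map_inv, map_pow, map_pow,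
      map_pow, map_pow, toAdd_mul, toAdd_inv, toAdd_pow, toAdd_pow, ha, ← hc]
    obtain ⟨d, hd⟩ := hdiv
    refine ⟨d, ?_⟩
    rw [nsmul_eq_mul, nsmul_eq_mul, Nat.cast_pow, pow_succ]
    linear_combination (p : ℤ_[p]) ^ k * hd
  exact ⟨i, u, humem, by rw [hu, mul_inv_cancel_left]⟩

/-- Hence `Γ_E = ⋃_i g^i · Gal(K̄_E/K_n·E)`. [folklore] -/
theorem exists_eq_pow_mul_layer_of_isUnit (g : Field.absoluteGaloisGroup E)
    (hg : IsUnit (κ (resGalOfEmb ι g)).toAdd) :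
    ∀ (n : ℕ) (τ : Field.absoluteGaloisGroup E),
      ∃ i : ℕ, ∃ u ∈ localLayerSubgroupOfEmb κ ι n, τ = g ^ i * u
  | 0, τ => ⟨0, τ, by simp [localLayerSubgroupOfEmb_zero], by simp⟩
  | n + 1, τ => by
    obtain ⟨i, u, hu, rfl⟩ := exists_eq_pow_mul_layer_of_isUnit g hg n τ
    obtain ⟨j, u', hu', rfl⟩ := exists_eq_pow_mul_of_isUnit κ ι g hg n hu
    exact ⟨i + p ^ n * j, u', hu', by rw [pow_add, pow_mul, mul_assoc]⟩

/-- And `g^d ∈ Gal(K̄_E/K_n·E) ↔ p^n ∣ d`. [folklore] -/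
theorem pow_mem_layer_iff_of_isUnit (g : Field.absoluteGaloisGroup E)
    (hg : IsUnit (κ (resGalOfEmb ι g)).toAdd) (n d : ℕ) :
    g ^ d ∈ localLayerSubgroupOfEmb κ ι n ↔ p ^ n ∣ d := by
  obtain ⟨c, hc⟩ := hg
  rw [mem_localLayerSubgroupOfEmb_iff, map_pow, map_pow, toAdd_pow, ← hc, nsmul_eq_mul]
  constructor
  · rintro ⟨e, he⟩
    have h1 : (p : ℤ_[p]) ^ n ∣ (d : ℤ_[p]) := by
      refine ⟨e * ((c⁻¹ : ℤ_[p]ˣ) : ℤ_[p]), ?_⟩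
      rw [← mul_assoc, ← he, mul_assoc, Units.mul_inv, mul_one]
    have h2 : ((d : ℤ) : ℤ_[p]) ∈ Ideal.span {(p : ℤ_[p]) ^ n} := by
      rw [Ideal.mem_span_singleton]; exact_mod_cast h1
    rw [← PadicInt.norm_le_pow_iff_mem_span_pow, PadicInt.norm_int_le_pow_iff_dvd] at h2
    exact_mod_cast h2
  · rintro ⟨e, rfl⟩
    exact ⟨(e : ℤ_[p]) * c, by rw [Nat.cast_mul, Nat.cast_pow]; ring⟩

/-- **`hgen` from ONE element with `κ(g|_{K̄}) ∈ ℤ_pˣ`**: a point of `E(K_{k+1}·E)` fixed by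
`g^{p^k}` lies in `E(K_k·E)`. [folklore] -/
theorem mem_layer_of_pow_smul_eq_of_isUnit (g : Field.absoluteGaloisGroup E)
    (hg : IsUnit (κ (resGalOfEmb ι g)).toAdd) (k : ℕ) {P : localPoints W E}
    (hP : P ∈ localLayerPointsOfEmb κ ι W (k + 1)) (hfix : (g ^ p ^ k) • P = P) :
    P ∈ localLayerPointsOfEmb κ ι W k := by
  rw [mem_localLayerPointsOfEmb_iff] at hP ⊢
  intro τ hτ
  obtain ⟨i, u, humem, rfl⟩ := exists_eq_pow_mul_of_isUnit κ ι g hg k hτ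
  have hgi : ∀ j : ℕ, ((g ^ p ^ k) ^ j) • P = P := fun j => by
    induction j with
    | zero => rw [pow_zero, one_smul]
    | succ j ih => rw [pow_succ, mul_smul, hfix, ih]
  rw [mul_smul, hP u humem, hgi]

/-- `hgen` in the shape consumed by `exists_finset_zeroClause_invariant_mod_pow`. [folklore] -/
theorem hgen_of_isUnit (g : Field.absoluteGaloisGroup E) (hg : IsUnit (κ (resGalOfEmb ι g)).toAdd)
    (n : ℕ) : ∀ k < n, ∀ P ∈ localLayerPointsOfEmb κ ι W (k + 1), (g ^ p ^ k) • P = P →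
      P ∈ localLayerPointsOfEmb κ ι W k :=
  fun k _ _ hP hfix => mem_layer_of_pow_smul_eq_of_isUnit κ ι W g hg k hP hfix

end Summit.BirchSwinnertonDyer.Rank1Residual.Additive.StrictSignedCount

end
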